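import Summits.HubbardSuperconductivity.HubbardSuperconductivity.Theorems.TwTipContinuation.Negative.TipNormalForm

/-!
# `TwTipContinuation` (stmt-HubbardSuperconductivity-1700), line `isogap-submodular-transport` —
# load-bearing side conditions of the Danskin stub (negative-side support, drefute)

The line's stub `stub_danskinAttainment` (skeleton fc3a0f08; finite-dimensional Danskin: a linear lower
bound `B·s ≤ E_L(U,0) − E_L(U,s)` on `0 < s < s₁` for the energy gain of the d-wave seed
`−(s/L²)(ΔᴴΔ)` in the sector `szSector (2n) 0` is attained by the pair intensity of some normalised sector
ground state of the pure torus) carries two side conditions. Both are LOAD-BEARING — the statement with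
either one deleted is false:

* `danskinAttainment_false_without_card` — without `n ≤ |Λ_L|`: on the `1 × 1` torus with `n = 2` the
  sector `(4, S^z = 0)` is `⊥`, both sector energies take the junk value `sInf ∅ = 0`, the gain
  hypothesis holds with `B = 0`, and no ground state exists;
* `danskinAttainment_false_without_seedPos` — without `0 < s₁`: at `s₁ = 0` the gain hypothesis is
  vacuous while `B` is free, but `re⟨ψ,(ΔᴴΔ)ψ⟩ ≤ C_d² L⁴` on unit vectors (`expect_pairIntensity_le`).

(The stub itself, with both conditions, is a theorem: corollary of `exists_groundState_order_of_uniformSeeds`,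
`Negative/SeedContinuity.lean`, and `leftChord_le_order`; candidate proof attached to the item as evidence.)
Folklore finite-dimensional bookkeeping (Tasaki 2020 §2.2 variational principle; junk value of `sInf ∅`);
no definition is introduced.
-/

noncomputable section

namespace Summit.HubbardSuperconductivity.TwTipContinuation.Negative

open Matrix Finset
open Literature.MathematicalPhysics.QuantumLattice Literature.Probability.LatticeModels
open scoped ComplexOrder

/-- **Danskin attainment without `n ≤ |Λ_L|` is false**: `L = 1`, `n = 2`, `U = 0`, `B = 0`, `s₁ = 1`
(empty sector, junk sector energies `0`, no ground state). [folklore] -/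
theorem danskinAttainment_false_without_card :
    ¬ ∀ (L : ℕ) [NeZero L] (U : ℝ) (n : ℕ) (B s₁ : ℝ), 0 < s₁ →
      (∀ s ∈ Set.Ioo (0 : ℝ) s₁, B * s ≤
        (Matrix.minEnergyOn (hubbardTorus 2 L 1 U) (szSector (2 * n) 0))
          - (Matrix.minEnergyOn (hubbardTorus 2 L 1 U - ((s / (L : ℝ) ^ 2 : ℝ) : ℂ) • ((pairField dWaveFormFactor L)ᴴ * pairField dWaveFormFactor L)) (szSector (2 * n) 0))) →
      ∃ ψ : Fock (Orb (FermionTorus 2 L)), star ψ ⬝ᵥ ψ = 1 ∧ IsGroundStateInSector (hubbardTorus 2 L 1 U) (2 * n) 0 ψ ∧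
        B * (L : ℝ) ^ 2 ≤ (expect ((pairField dWaveFormFactor L)ᴴ * pairField dWaveFormFactor L) ψ).re := by
  intro h
  have hempty : ∀ (A : Matrix (Finset (Orb (FermionTorus 2 1))) (Finset (Orb (FermionTorus 2 1))) ℂ),
      A.minEnergyOn (szSector (Λ := FermionTorus 2 1) (2 * 2) (0 : ℝ)) = 0 := by
    intro A
    rw [Matrix.minEnergyOn]
    have : {E : ℝ | ∃ ψ ∈ szSector (Λ := FermionTorus 2 1) (2 * 2) (0 : ℝ), star ψ ⬝ᵥ ψ = 1 ∧
        E = (star ψ ⬝ᵥ A *ᵥ ψ).re} = ∅ := by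
      ext E
      simp only [Set.mem_setOf_eq, Set.mem_empty_iff_false, iff_false, not_exists, not_and]
      intro ψ hψ hunit _
      have hne : ψ ≠ 0 := by
        intro h0
        rw [h0, dotProduct_zero] at hunit
        exact zero_ne_one hunit
      have := le_card_of_mem_szSector 1 hψ hne
      rw [Summit.HubbardSuperconductivity.NoGo.card_fermionTorus_two] at this
      omega
    rw [this, Real.sInf_empty]
  have hyp : ∀ s ∈ Set.Ioo (0 : ℝ) 1, (0 : ℝ) * s ≤
      (Matrix.minEnergyOn (hubbardTorus 2 1 1 0) (szSector (2 * 2) 0))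
        - (Matrix.minEnergyOn (hubbardTorus 2 1 1 0 - ((s / ((1 : ℕ) : ℝ) ^ 2 : ℝ) : ℂ) • ((pairField dWaveFormFactor 1)ᴴ * pairField dWaveFormFactor 1)) (szSector (2 * 2) 0)) := by
    intro s _
    rw [hempty, hempty]
    simp
  obtain ⟨ψ, -, hgs, -⟩ := h 1 0 2 0 1 one_pos hyp
  have := le_card_of_mem_szSector 1 hgs.1 hgs.2.1
  rw [Summit.HubbardSuperconductivity.NoGo.card_fermionTorus_two] at this
  omega

/-- **Danskin attainment without `0 < s₁` is false**: `L = 1`, `n = 0`, `s₁ = 0`, `B = C_d² + 1`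
(vacuous gain hypothesis against the crude bound `re⟨ψ,(ΔᴴΔ)ψ⟩ ≤ C_d² L⁴`). [folklore] -/
theorem danskinAttainment_false_without_seedPos :
    ¬ ∀ (L : ℕ) [NeZero L] (U : ℝ) (n : ℕ) (B s₁ : ℝ), n ≤ Fintype.card (FermionTorus 2 L) →
      (∀ s ∈ Set.Ioo (0 : ℝ) s₁, B * s ≤
        (Matrix.minEnergyOn (hubbardTorus 2 L 1 U) (szSector (2 * n) 0))
          - (Matrix.minEnergyOn (hubbardTorus 2 L 1 U - ((s / (L : ℝ) ^ 2 : ℝ) : ℂ) • ((pairField dWaveFormFactor L)ᴴ * pairField dWaveFormFactor L)) (szSector (2 * n) 0))) →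
      ∃ ψ : Fock (Orb (FermionTorus 2 L)), star ψ ⬝ᵥ ψ = 1 ∧ IsGroundStateInSector (hubbardTorus 2 L 1 U) (2 * n) 0 ψ ∧
        B * (L : ℝ) ^ 2 ≤ (expect ((pairField dWaveFormFactor L)ᴴ * pairField dWaveFormFactor L) ψ).re := by
  intro h
  set C : ℝ := (∑ e ∈ insert 0 unitSteps, ‖((dWaveFormFactor e / Real.sqrt 2 : ℝ) : ℂ)‖ * 2) ^ 2 with hC
  have hyp : ∀ s ∈ Set.Ioo (0 : ℝ) 0, (C + 1) * s ≤
      (Matrix.minEnergyOn (hubbardTorus 2 1 1 0) (szSector (2 * 0) 0))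
        - (Matrix.minEnergyOn (hubbardTorus 2 1 1 0 - ((s / ((1 : ℕ) : ℝ) ^ 2 : ℝ) : ℂ) • ((pairField dWaveFormFactor 1)ᴴ * pairField dWaveFormFactor 1)) (szSector (2 * 0) 0)) := by
    intro s hs
    exact absurd hs.2 (not_lt.2 hs.1.le)
  obtain ⟨ψ, hψ, -, hB⟩ := h 1 0 0 (C + 1) 0 (Nat.zero_le _) hyp
  have hP := expect_pairIntensity_le 1 ψ hψ
  rw [← hC] at hP
  simp only [Nat.cast_one, one_pow, mul_one] at hB hP
  linarith

end Summit.HubbardSuperconductivity.TwTipContinuation.Negative
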